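import Mathlib
import HarnessLib
import HarnessLib.Audit
import Summits.Langlands.Statement
import Summits.Langlands.Langlands.Theses.EllipticDegreeLadder
import Literature.NumberTheory.Automorphic.ThorneQInfinityModular
import HarnessLib.Audit.Status.Attr

/-!
Route: TowerDoorSplit

# Route TowerDoorSplit — «beyond degree 5 the modularity of elliptic curves over totally real fields
is not known field by field but TOWER by TOWER: it is a theorem in print for abelian fields
unramified at 3·5·7 (Yoshikawa 2019) and for the layers of the cyclotomic ℤ_p-extension of ℚ (Thorne
2019), and Yoshikawa's 2022 door — 'if X₀(15) (resp. X₀(21)) acquires no new points in an odd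
extension K₀/F, every non-modular curve over K₀ has j ∈ F' — is a statement about an ARBITRARY base
F and an ARBITRARY odd solvable Galois cover, whose only field-dependent input, modularity over F,
is exactly the host's base range (degree ≤ 5); so the high-degree elliptic cell HIGH of GL₂
reciprocity splits, by how the totally-real witness field is ANCHORED to the base range, into a
print cell, two print-bridge cells that consume the host rungs by name, and one honest residual:
witnesses over unanchored fields of degree ≥ 6».

It suffices to show the four cells A, B5, B7, REST below (each = HIGH's text verbatim with one
conjunct on the witness field appended); `closes : A → B5 → B7 → REST →
HighDegreeEllipticAutomorphy` is three excluded middles (node kernel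
`Theorems.TowerDoorSplit.Cert.high_iff_cells : HIGH ↔ A ∧ B5 ∧ B7 ∧ REST`, 0 sorry).
Lean: AbelianOrCyclotomicWitnessAutomorphy → FifteenStableCoverWitnessAutomorphy →
TwentyOneStableCoverWitnessAutomorphy → UnanchoredHighDegreeWitnessAutomorphy →
Summit.Langlands.Langlands.Theses.EllipticDegreeLadder.HighDegreeEllipticAutomorphy

REFINES route-Langlands-EllipticDegreeLadder:HighDegreeEllipticAutomorphy (edge split, depth 1;
chain route-Langlands-EllipticDegreeLadder › route-Langlands-TowerDoorSplit) — the deciding theorem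
of this CHILD route concludes the parent piece
`Summit.Langlands.Langlands.Theses.EllipticDegreeLadder.HighDegreeEllipticAutomorphy` BY NAME
(imported from Summits.Langlands.Langlands.Theses.EllipticDegreeLadder); closing this route proves
that piece of the parent, never the summit Statement (D-0170).

Rationale: WHY THIS LINE. HIGH (stmt-Langlands-31034, crux rank 201 of route-Langlands-EllipticDegreeLadder,
OPEN, attempts 0, never cut; layer-2 child of OFF 30186 under the landed glue
`Theorems.OffLadderRankTwoAutomorphy_of_split_proof`) is weak automorphy of every irreducible
pinned-geometric twist-primitive ρ : Γ_K → GL₂(ℚ̄_ℓ) that has a totally-real elliptic sandwich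
witness E/K₀ but none over a field of degree ≤ 5; its host docstring reads it as «modularity of all
curves over TR fields of degree ≥ 6 — towers/doors, Kato ETNC + Iwasawa control of X₀(15), X₀(21)»
and files it as ONE item.  Lens 5 read on the WITNESS FIELD rather than on the curve gives a finer
and kernel-exact picture: (base range) the host rungs `SubquarticModularity` 30188 /
`QuarticModularity` 17832 / `QuinticModularity` 30187; (asymptotic regime, unbounded degree)
families of fields on which modularity of every curve is PRINT — K₀/ℚ abelian unramified at 3, 5, 7
[Yoshikawa2019, Thm 1.2 = tree fact `Yoshikawa2019_theorem1_2`; corpus:paper-arxiv-1606.06597 p3] or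
K₀ ⊂ ℚ(ζ_{p^∞}) [Thorne2019, Thm 1 = tree fact `Thorne2019_thm1`] — cell A; (bridge) Yoshikawa's
door [Yoshikawa2022, Cor 3.6; corpus:paper-arxiv-2206.12860 p5: «If ρ̄_{E,5} is reducible, then E
gives an F′-rational point on X(s3,b5) or X₀(15) … P is indeed an F-rational point. Therefore, the
j-invariant of E is in F, and the modularity of E follows from [modularity over F] and the cyclic
base change»], whose proof uses of the base F only «every curve over F is modular» and of F′/F only
«odd degree» (Lemma 3.2/Cor 3.3: X(s3,b5) → X₀(15) has degree 2) — so it relativises VERBATIM to any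
subfield F with [F:ℚ] ≤ 5 and any odd solvable Galois cover K₀/F along which X₀(15) =
`Thorne2019.E₁` (resp. X₀(21) = [1,0,0,−4,−1], Lemma 3.1 (3)) is stable: cells B5 (√5 ∉ K₀, Thorne
2016 Thm 7.6 = `Thorne2019_thm2_five`) and B7 (7 unramified, Yoshikawa 2016 Thm 1.5
[corpus:paper-arxiv-1606.06597 p3]); (residual) REST = witnesses over fields with no such anchor.
Imported from other areas: Iwasawa theory / Euler systems enter only as the INSTRUMENT certifying
the guard «X₀(15)(K₀) = X₀(15)(F)» tower by tower ([Thorne2019, Thm 5] = `Thorne2019_thm5` over ℚ: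
Kato + 3-, 5-adic main conjectures; [Yoshikawa2022, Prop 4.6 + Tables 1–2] over real quadratic F;
[Zhang2023] likewise) — never as a hypothesis of an item.
RANKED CRUXES. rank 2 B5 `FifteenStableCoverWitnessAutomorphy` (PRINT BRIDGE · ATTACKABLE-NOW):
birth = `stub_door15` (the relative door, print by proof) + `stub_twistDescent`
(Langlands/Arthur–Clozel along the solvable K₀/F + quadratic twist, print) + `stub_baseRange` (= the
three host rungs, `baseRange_of_rungs`) + `stub_transport` (ETP by name) + W⁺|₂ + R1; composition
`b5_of_pieces` kernel-checked.  rank 3 B7 `TwentyOneStableCoverWitnessAutomorphy` (PRINT BRIDGE ·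
ATTACKABLE-NOW; one more Literature fact to file: Yoshikawa 2016 Thm 1.5).  rank 4 REST
`UnanchoredHighDegreeWitnessAutomorphy` (DECLARED RESIDUAL · IDEA-NEEDED): birth =
`stub_integralModel` (routine) + `stub_unanchored` (E-level: every curve over every unanchored TR
field of degree ≥ 6 is modular — strictly weaker than the host's reading of HIGH,
`unanchored_of_highDegree`) + TRANY 31038 + W⁺|₂ + R1.  Supports: A
`AbelianOrCyclotomicWitnessAutomorphy` (rank 9, CLOSED AT BIRTH modulo ETP/W⁺|₂/R1 from the two
NAMED tree facts: `a_of_pieces`), ETP `EllipticTransportPointwise` (rank 9, text identical to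
route-Langlands-CMRestImageLocusSplit's item — dedup).  TEETH (instances of each cell certified in
print, all of degree ≥ 6 as the kernel lemma `Cert.six_le_finrank_of_witness` demands): A — ℚ(ζ₁₃)⁺,
ℚ_2^{(3)} (degree 9); B5∖A — ℚ(√2)·ℚ_n^{(7)} ([Yoshikawa2022] Table 1: L(X₀(15)_2,1)/Ω = 2, p = 7 ⇒
no growth; corpus:paper-arxiv-2206.12860 p10), ℚ(√21)·ℚ_n^{(11)}; B7∖(A∪B5) — ℚ(√5)·ℚ_n^{(11)}
(Table 2: L(X₀(21)_5,1)/Ω = 1; p11); REST — a generic S₆-sextic.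
KILL CRITERIA. (i) A refuter shows the relative door FALSE as typed — e.g. a non-modular-candidate E
over some K₀ with j ∉ F although X₀(15)(K₀) = X₀(15)(F): impossible by Yoshikawa's proof unless
FLS's small-image dichotomy at 3 fails to relativise (it is stated for every totally real field
[FreitasLeHungSiksek2015, Thm 3/4]) — then B5/B7 lose their bridge and the route degrades to A +
residual (retire).  (ii) `SolvableTwistDescent` false for a solvable non-abelian K₀/F because
cuspidality dies at a quadratic step for a CM curve: handled by the `HasCM` disjunct of the tree's
modularity predicate; a counterexample outside CM kills the typed statement (re-type with the CM
case split explicit).  (iii) The tree's `IsInCyclotomicZpExtension` or the abelian hypothesis of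
`Yoshikawa2019_theorem1_2` is junk (vacuous/unsatisfiable): A collapses into REST — the cut survives
but loses its print cell (bc7 CLEAN ×4 says no).  (iv) Someone lands `HIGH` outright or a cell →
HIGH cheaply (probes say no): the node is moot.
NOT DECOMPOSED YET. REST is NOT cut further (no field family of degree ≥ 6 outside A/B5/B7 has print
modularity; cutting by degree is the host ladder's axis, by residual image is lens-5-g5's, both
would replicate).  B5/B7 are NOT split per tower (each tower ℚ_n^{(p)}·F is an INSTRUMENT instance:
a Mordell–Weil/Iwasawa certificate per (F, p), logged on the cell, never an item — HeptagonalTower's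
items `OddDegreeDoor` 16840 / `KatoRankZeroSeven` 16841 / `TorsionSeven` 16842 are that instrument
for F = ℚ, p = 7 and are cited, not refiled).  The even-degree solvable covers (where X(s3,b5) may
grow without X₀(15) growing) and insoluble anchors are inside REST by construction.  DEPTH RULE:
below B only vendoring + instruments; below REST nothing until a modularity theorem for a NAMED
family of unanchored fields exists (then it becomes a fourth dial, same kernel).
CHEAPEST FALSIFIER. Minutes, literature: Cor 3.6's proof must use nothing about F beyond modularity
over F and nothing about F′/F beyond odd degree — checked verbatim [corpus:paper-arxiv-2206.12860
p4–5: Lemma 3.2 («[F′:F] odd … F′ ∩ F″ = F»), Cor 3.3, proof of Cor 3.6]; Lemma 3.1 (3) must give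
X₀(21) ≅ 21A1 = [1,0,0,−4,−1] (checked; c₄ = 193, Δ = 3⁴·7² kernel-checked in the node, j =
193³/3969 = Lemma 3.1 (5)).  Seconds, in Lean: kit probes (136 expected failures: no cell / drop-one
triple / stub / named fact gives HIGH, Langlands or its cell) and bc7 CLEAN ×9.  Days, refuter:
exhibit ONE totally real K₀ of degree ≥ 6 in B5∖A together with a curve E/K₀ reducible at 3 and 5
with j ∉ F — that refutes `stub_door15` (and Yoshikawa's Cor 3.6 with it).

Novelty: Searches RUN (2026-08-31, this seat; corpus fts+vec AND galaxy AND citation graph, labelled).  `lit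
search "modularity elliptic curves Zp-extension totally real" --source all` → local
[corpus:paper-arxiv-2206.12860 p1,p5] Yoshikawa 2022, [corpus:paper:doi-10-4171-8ecm p681] Thorne's
ECM survey («Establishing the modularity of elliptic curves over all totally real fields will
require new ideas»), remote crossref: [Yoshikawa2019] doi:10.5802/jtnb.1047, [Zhang2023]
doi:10.1007/s11139-022-00686-x (cyclotomic ℤ_p-extensions of some real quadratic fields — same shape
as Yoshikawa 2022), [DerickxNajmanSiksek2020], [Box2022], [IshitsukaItoYoshikawa2021] (the base
range); `lit search --hybrid "rational points X0(15) odd degree extension modular"` and `lit vsearch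
"every elliptic curve over an odd degree solvable extension with no new points on X_0(15) is
modular"` → only the two Yoshikawa papers and FLS-lineage pages [corpus:paper-arxiv-2206.12860
p4–5]; `lit galaxy search "X_0(15)|X0(15)|Z_p-extension" --star pdf` and `"Zp-extension of a real
quadratic|curves over Q_infty are modular|rational points on X0(15)" --star all` → no hits (galaxy
null, both recorded); `lit citing arxiv:2206.12860 --source api` → 0 citers
[graph:arxiv:2206.12860]; `lit citing arxiv:1505.04769` → local graph 0, API rate-limited (null
recorded).  In the tree (rg over Summits/Langlands): `IsInCyclotomicZpExtension` / `PointsRational`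
/ `Thorne2019.E₁` occur only E-level — route-Langlands-HeptagonalTower (F = ℚ,  [refs: 10.5802/jtnb.1047, 10.1007/s11139-022-00686-x, 2206.12860, 1505.04769, paper-arxiv-2206.12860, paper:doi-10-4171-8ecm, doi:10.5802/jtnb.1047, doi:10.1007/s11139-022-00686-x, arxiv:2206.12860, arxiv:1505.04769, Yoshikawa2019, Zhang2023, DerickxNajmanSiksek2020, Box2022, IshitsukaItoYoshikawa2021, Thorne2019, Yoshikawa2022]

Barriers (technique_class: modularity-switching, moduli descent, solvable BC, towers): - technique_class: modularity-switching (3–5, 3–7 at the residual level: FLS 2015, Thorne 2016,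
Yoshikawa 2016), modular-curve-points (X₀(15), X(s3,b5), X₀(21), X(s3,b7): descent of K₀-points to a
subfield along odd-degree covers), solvable base change (Langlands 1980 / Arthur–Clozel 1989) +
quadratic twist, residually-reducible lifting over abelian fields (Skinner–Wiles via Yoshikawa 2019)
and Iwasawa control of Mordell–Weil in ℤ_p-towers (Kato, Kurihara — instrument only),
elliptic-sandwich transport (g7/g8 grammar).
- Literature.Barriers.Langlands.ResiduallyReducibleBarrier: A sits INSIDE the barrier's locus for
its exceptional curves and is DISCHARGED IN PRINT ([Yoshikawa2019] uses Skinner–Wiles' residually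
reducible ordinary lifting, available because K₀/ℚ is abelian; [Thorne2019] uses the ℚ-door +
Iwasawa control) — imported as named facts, nothing claimed beyond them.  B5/B7 sit EXACTLY ON the
barrier's locus (ρ̄_{E,5} resp. ρ̄_{E,7} reducible and ρ̄_{E,3} small) and EVADE it rather than beat
it: a residually small curve is a K₀-point of a modular curve of genus 1 (X₀(15) = 15A1, X₀(21) =
21A1) or of its degree-2 cover, the guard forces that point down to F, hence j(E) ∈ F, and
modularity is then imported from the base range (degree ≤ 5, host rungs) by solvable base change —
no lifting theorem is applied to a residually reducible ρ̄ anywhere in B5/B7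
[corpus:paper-arxiv-2206.12860 p5, proof of Cor 3.6].  REST is INSIDE with no evasion (unanchored
fields: no descent tar

sub-problem: Langlands · status: draft · opened planner-decomp-langlands-writer-1-g8-0 2026-08-31T09:21:53Z · rev 1 · ledger route-Langlands-TowerDoorSplit
GENERATED by the gate from the ledger (D-0016/17). Provers cite these decls: `theorem foo : Summit.Langlands.Langlands.Theses.TowerDoorSplit.<Decl> := …` in Summits/Langlands/Langlands/Theorems/<Name>.lean.
-/

namespace Summit.Langlands.Langlands.Theses.TowerDoorSplit

open scoped BigOperators Topology Manifold Classical MeasureTheory ProbabilityTheory Matrix InnerProductSpace ComplexConjugate ContinuousMap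
open Filter Set Function TopologicalSpace MeasureTheory

attribute [summit_statement] _root_.Langlands
attribute [summit_statement] _root_.Summit.Langlands.Langlands.Theses.EllipticDegreeLadder.HighDegreeEllipticAutomorphy

/-- item stmt-Langlands-26996 · crux · leaf ATTACKABLE · rank 2 · open · by planner
why it might fail: Print by PROOF not by statement: the door needs FLS's small-image-at-3 dichotomy and the moduli of X₀(15)/X(s3,b5) as RELATIVE Lean statements (K₀-points ↔ level structures), unvendored; and iterated cyclic base change along a non-abelian solvable K₀/F must keep cuspidality (CM at quadratic steps).
sources: corpus:paper-arxiv-2206.12860 p4 (Lemma 3.1: X₀(15)≅15A1, X(s3,b5)≅15A3, X₀(21)≅21A1; Lemma 3.2 odd degree), p5 (Cor 3.3, Thm 3.4 = Thorne 2016 Thm 7.6, Thm 3.5 = Yoshikawa 2016 Thm 1.5, Cor 3.6 + proof), p10–11 (Tables 1–2: certified towers), Yoshikawa2022, Thorne2016 (Math. Ann.: Thm 7.6 = tree Thorne2019_thm2_five), FreitasLeHungSiksek2015 (arXiv:1310.7088: Thm 3/4 small image at 3; X(b3,b5), X(s3,b5)), ArthurClozel1989 / Langlands1980 (tree: ArthurClozel1989_weakLifting_cuspidal,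 baseChange_cyclic_cuspidal), Thorne2019 (Thm 5, Lemma 3 = tree Thorne2019_thm5, Thorne2019_lemma3: the F = ℚ instrument)
[crux · B5 · PRINT BRIDGE · ATTACKABLE-NOW · WEAKER-or-equal than HIGH 31034
(`Theorems.TowerDoorSplit.Cert.b5_of_high`; no `B5 → HIGH`, `→ Langlands`, `→ A/B7/REST`: kit probes
P2/P11, bc7b/f CLEAN) · S-implied (`Cert.b5_of_langlands`)] HIGH's text VERBATIM (K, ρ irreducible
pinned-geometric twist-primitive of rank 2; ¬(TR witness of degree ≤ 5) ∧ (TR witness) ⇒ weakly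
automorphic) with ONE conjunct appended inside the hypothesis block: ¬WA ∧ WB5 — ρ has NO integral
totally-real sandwich witness over an abelian-unramified-at-3·5·7 or cyclotomic-ℤ_p-layer field, but
HAS one, E : WeierstrassCurve (𝓞 K₀) with (E.baseChange K₀).IsElliptic, over a totally real K₀ with
¬ IsSquare (5 : K₀) and ∃ F : IntermediateField ℚ K₀ with finrank ℚ F ≤ 5, IsGalois F K₀, IsSolvable
(K₀ ≃ₐ[F] K₀), Odd (finrank F K₀) and every K₀-point (x, y) of X₀(15) = `Thorne2019.E₁` =
[1,1,1,−10,−10] having x, y ∈ range (algebraMap F K₀).  By `Cert.six_le_finrank_of_witness` such K₀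
has degree ≥ 6 (so [K₀:F] is an odd number ≥ 3, or F has degree ≥ 2).  CLOSES (kernel-checked
`b5_of_pieces`, 0 sorry) from: the RELATIVE DOOR `RelativeDoorFifteen` (print by proof: Yoshikawa
2022 Cor 3.6 (1) with real-quadratic-base/ℤ_ -/
@[route_item "route-Langlands-TowerDoorSplit", crux (bottleneck := work) (source := "ledger D-0171 leaf tag ATTACKABLE on stmt-Langlands-26996, 2026-09-01")]
def FifteenStableCoverWitnessAutomorphy : Prop :=
  ∀ (K : Type) [Field K] [NumberField K] (hcpt : Literature.NumberTheory.Automorphic.isCompact_glFiniteIntegralLevel 2 K) (ℓ : ℕ) [Fact ℓ.Prime] (ι : PadicAlgCl ℓ ≃+* ℂ) (ρ : Literature.NumberTheory.GaloisRepresentations.FramedGaloisRep K (PadicAlgCl ℓ) 2), ρ.toGaloisRep.IsIrreducible → ((∀ᶠ v : IsDedekindDomain.HeightOneSpectrum (NumberField.RingOfIntegers K) in Filter.cofinite, ρ.IsUnramifiedAt v) ∧ ∀ (v : IsDedekindDomain.HeightOneSpectrum (NumberField.RingOfIntegers K)) (hv : ((ℓ : ℕ) : NumberField.RingOfIntegers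 K) ∈ v.asIdeal), (Literature.NumberTheory.PAdicHodge.fontainePstAdicCompletion v ℓ hv).IsDeRhamFramed (ρ.toLocal v)) → ¬ (∃ η : Literature.NumberTheory.GaloisRepresentations.FramedGaloisRep K (PadicAlgCl ℓ) 1, (∃ᶠ v : IsDedekindDomain.HeightOneSpectrum (NumberField.RingOfIntegers K) in Filter.cofinite, ∃ a : PadicAlgCl ℓ, a ≠ 1 ∧ η.HasFrobCharpolyAt v (Polynomial.X - Polynomial.C a)) ∧ ∀ᶠ v : IsDedekindDomain.HeightOneSpectrum (NumberField.RingOfIntegers K) in Filter.cofinite, ∃ (P : Polynomial (PadicAlgCl ℓ)) (a : PadicAlgCl ℓ), ρ.HasFrobCharpolyAt v P ∧ η.HasFrobCharpolyAt v (Polynomial.X - Polynomial.C a) ∧ P.scaleRoots a = P) → (¬ (∃ (L : Type) (_ : Field L) (_ : NumberField L) (_ : Algebra K L), IsGalois K L ∧ IsSolvable (L ≃ₐ[K] L) ∧ ∃ (K₀ : Type) (_ : Field K₀) (_ : NumberField K₀) (_ : Algebra K₀ L), IsGalois K₀ L ∧ IsSolvable (L ≃ₐ[K₀] L) ∧ NumberField.IsTotallyReal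 K₀ ∧ Module.finrank ℚ K₀ ≤ 5 ∧ ∃ (E : WeierstrassCurve K₀) (_ : E.IsElliptic) (χ : Literature.NumberTheory.GaloisRepresentations.FramedGaloisRep L (PadicAlgCl ℓ) 1), ∀ g : Field.absoluteGaloisGroup L, Literature.NumberTheory.GaloisRepresentations.FramedRep.trace (ρ.restrictField L) g = Literature.NumberTheory.GaloisRepresentations.FramedRep.trace χ g * Literature.NumberTheory.GaloisRepresentations.FramedRep.trace ((E.framedTateGaloisRep ℓ).restrictField L) g) ∧ (∃ (L : Type) (_ : Field L) (_ : NumberField L) (_ : Algebra K L), IsGalois K L ∧ IsSolvable (L ≃ₐ[K] L) ∧ ∃ (K₀ : Type) (_ : Field K₀) (_ : NumberField K₀) (_ : Algebra K₀ L), IsGalois K₀ L ∧ IsSolvable (L ≃ₐ[K₀] L) ∧ NumberField.IsTotallyReal K₀ ∧ ∃ (E : WeierstrassCurve K₀) (_ : E.IsElliptic) (χ : Literature.NumberTheory.GaloisRepresentations.FramedGaloisRep L (PadicAlgCl ℓ) 1), ∀ g : Field.absoluteGaloisGroup L, Literature.NumberTheory.GaloisRepresentations.FramedRep.trace (ρ.restrictField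 L) g = Literature.NumberTheory.GaloisRepresentations.FramedRep.trace χ g * Literature.NumberTheory.GaloisRepresentations.FramedRep.trace ((E.framedTateGaloisRep ℓ).restrictField L) g) ∧ ¬ (∃ (L : Type) (_ : Field L) (_ : NumberField L) (_ : Algebra K L), IsGalois K L ∧ IsSolvable (L ≃ₐ[K] L) ∧ ∃ (K₀ : Type) (_ : Field K₀) (_ : NumberField K₀) (_ : Algebra K₀ L), IsGalois K₀ L ∧ IsSolvable (L ≃ₐ[K₀] L) ∧ NumberField.IsTotallyReal K₀ ∧ ((IsGalois ℚ K₀ ∧ (∀ σ τ : K₀ ≃ₐ[ℚ] K₀, σ * τ = τ * σ) ∧ ¬ ((3 : ℤ) ∣ NumberField.discr K₀) ∧ ¬ ((5 : ℤ) ∣ NumberField.discr K₀) ∧ ¬ ((7 : ℤ) ∣ NumberField.discr K₀)) ∨ (∃ p : ℕ, p.Prime ∧ Literature.NumberTheory.Automorphic.Thorne2019.IsInCyclotomicZpExtension p K₀)) ∧ ∃ (E : WeierstrassCurve (NumberField.RingOfIntegers K₀)) (_ : (E.baseChange K₀).IsElliptic) (χ : Literature.NumberTheory.GaloisRepresentations.FramedGaloisRep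 L (PadicAlgCl ℓ) 1), ∀ g : Field.absoluteGaloisGroup L, Literature.NumberTheory.GaloisRepresentations.FramedRep.trace (ρ.restrictField L) g = Literature.NumberTheory.GaloisRepresentations.FramedRep.trace χ g * Literature.NumberTheory.GaloisRepresentations.FramedRep.trace (((E.baseChange K₀).framedTateGaloisRep ℓ).restrictField L) g) ∧ (∃ (L : Type) (_ : Field L) (_ : NumberField L) (_ : Algebra K L), IsGalois K L ∧ IsSolvable (L ≃ₐ[K] L) ∧ ∃ (K₀ : Type) (_ : Field K₀) (_ : NumberField K₀) (_ : Algebra K₀ L), IsGalois K₀ L ∧ IsSolvable (L ≃ₐ[K₀] L) ∧ NumberField.IsTotallyReal K₀ ∧ (¬ IsSquare (5 : K₀) ∧ ∃ F : IntermediateField ℚ K₀, Module.finrank ℚ F ≤ 5 ∧ IsGalois F K₀ ∧ IsSolvable (K₀ ≃ₐ[F] K₀) ∧ Odd (Module.finrank F K₀) ∧ ∀ x y : K₀, (Literature.NumberTheory.Automorphic.Thorne2019.E₁.baseChange K₀).toAffine.Equation x y → x ∈ Set.range (algebraMap F K₀) ∧ y ∈ Set.range (algebraMap F K₀)) ∧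 ∃ (E : WeierstrassCurve (NumberField.RingOfIntegers K₀)) (_ : (E.baseChange K₀).IsElliptic) (χ : Literature.NumberTheory.GaloisRepresentations.FramedGaloisRep L (PadicAlgCl ℓ) 1), ∀ g : Field.absoluteGaloisGroup L, Literature.NumberTheory.GaloisRepresentations.FramedRep.trace (ρ.restrictField L) g = Literature.NumberTheory.GaloisRepresentations.FramedRep.trace χ g * Literature.NumberTheory.GaloisRepresentations.FramedRep.trace (((E.baseChange K₀).framedTateGaloisRep ℓ).restrictField L) g)) → ∃ π : Literature.NumberTheory.Automorphic.CuspidalAutomorphicRepData 2 K hcpt, π.1.IsLAlgebraic ∧ ∀ᶠ v : IsDedekindDomain.HeightOneSpectrum (NumberField.RingOfIntegers K) in Filter.cofinite, SatakeFrobCompatibleAt ι π.1 ρ v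

/-- item stmt-Langlands-26997 · crux · leaf ATTACKABLE · rank 3 · open · by planner
why it might fail: Yoshikawa 2016 Thm 1.5 (7 unramified ∧ ρ̄₇ irreducible ⇒ modular) is not a tree fact yet and hides image conditions over K₀(ζ₇) handled inside its proof; the relativised moduli statement for X(s3,b7) (genus 3, degree-2 map to X₀(21)) must be typed, not just X₀(21)'s.
sources: corpus:paper-arxiv-2206.12860 p4 (Lemma 3.1: X₀(15)≅15A1, X(s3,b5)≅15A3, X₀(21)≅21A1; Lemma 3.2 odd degree), p5 (Cor 3.3, Thm 3.4 = Thorne 2016 Thm 7.6, Thm 3.5 = Yoshikawa 2016 Thm 1.5, Cor 3.6 + proof), p10–11 (Tables 1–2: certified towers), corpus:paper-arxiv-1606.06597 p3 (Yoshikawa 2016/2019 Thm 1.5: 7 unramified + ρ̄₇ irreducible ⇒ modular; Thm 1.6 = Thorne), Yoshikawa2019 (doi:10.5802/jtnb.1047), FreitasLeHungSiksek2015 (X(b5,b7), X(b3,b7), X(s3,b7); 3–7 switching), tree: Thorne2019.E₁/PointsRational grammar (ThorneQInfinityModular.lean), HeptagonalTower (7-tower instrument), EllipticDegreeLadder rungs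 30188/17832/30187
[crux · B7 · PRINT BRIDGE · ATTACKABLE-NOW · WEAKER-or-equal than HIGH (`Cert.b7_of_high`; no `B7 →
HIGH` / `→ Langlands` / `→ B5`: probes P3/P12, bc7c/g CLEAN) · S-implied (`Cert.b7_of_langlands`)]
HIGH VERBATIM with ONE conjunct appended: ¬WA ∧ ¬WB5 ∧ WB7 — no anchored witness of kind A or B5,
but SOME integral totally-real sandwich witness over a K₀ with ¬ ((7 : ℤ) ∣ NumberField.discr K₀) (7
unramified) and ∃ F : IntermediateField ℚ K₀, finrank ℚ F ≤ 5 ∧ IsGalois F K₀ ∧ IsSolvable (K₀ ≃ₐ[F]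
K₀) ∧ Odd (finrank F K₀) ∧ every K₀-point of X₀(21) = [1, 0, 0, −4, −1] (21A1; Yoshikawa 2022 Lemma
3.1 (3); c₄ = 193, Δ = 3⁴·7², kernel-checked `xZeroTwentyOne_c₄/_Δ`) is F-rational in both
coordinates.  CLOSES (`b7_of_pieces`, 0 sorry) from the RELATIVE DOOR AT 21 `RelativeDoorTwentyOne`
(print by proof: Cor 3.6 (2) relativised — Yoshikawa 2016 Thm 1.5 [corpus:paper-arxiv-1606.06597 p3:
«Let K be a totally real field in which 7 is unramified. If E is an elliptic curve over K with
ρ̄_{E,7} (absolutely) irreducible, then E is modular»], FLS Thm 3/4, moduli of X₀(21) = X(b3,b7) and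
X(s3,b7) → X₀(21) of degree 2 (Lemma 3.1 (4)), Cor 3.3 (2)), `SolvableTwistDescent`, the base range
BY NAME, ETP, -/
@[route_item "route-Langlands-TowerDoorSplit", crux (bottleneck := work) (source := "ledger D-0171 leaf tag ATTACKABLE on stmt-Langlands-26997, 2026-09-01")]
def TwentyOneStableCoverWitnessAutomorphy : Prop :=
  ∀ (K : Type) [Field K] [NumberField K] (hcpt : Literature.NumberTheory.Automorphic.isCompact_glFiniteIntegralLevel 2 K) (ℓ : ℕ) [Fact ℓ.Prime] (ι : PadicAlgCl ℓ ≃+* ℂ) (ρ : Literature.NumberTheory.GaloisRepresentations.FramedGaloisRep K (PadicAlgCl ℓ) 2), ρ.toGaloisRep.IsIrreducible → ((∀ᶠ v : IsDedekindDomain.HeightOneSpectrum (NumberField.RingOfIntegers K) in Filter.cofinite, ρ.IsUnramifiedAt v) ∧ ∀ (v : IsDedekindDomain.HeightOneSpectrum (NumberField.RingOfIntegers K)) (hv : ((ℓ : ℕ) : NumberField.RingOfIntegers K) ∈ v.asIdeal), (Literature.NumberTheory.PAdicHodge.fontainePstAdicCompletion v ℓ hv).IsDeRhamFramed (ρ.toLocal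 v)) → ¬ (∃ η : Literature.NumberTheory.GaloisRepresentations.FramedGaloisRep K (PadicAlgCl ℓ) 1, (∃ᶠ v : IsDedekindDomain.HeightOneSpectrum (NumberField.RingOfIntegers K) in Filter.cofinite, ∃ a : PadicAlgCl ℓ, a ≠ 1 ∧ η.HasFrobCharpolyAt v (Polynomial.X - Polynomial.C a)) ∧ ∀ᶠ v : IsDedekindDomain.HeightOneSpectrum (NumberField.RingOfIntegers K) in Filter.cofinite, ∃ (P : Polynomial (PadicAlgCl ℓ)) (a : PadicAlgCl ℓ), ρ.HasFrobCharpolyAt v P ∧ η.HasFrobCharpolyAt v (Polynomial.X - Polynomial.C a) ∧ P.scaleRoots a = P) → (¬ (∃ (L : Type) (_ : Field L) (_ : NumberField L) (_ : Algebra K L), IsGalois K L ∧ IsSolvable (L ≃ₐ[K] L) ∧ ∃ (K₀ : Type) (_ : Field K₀) (_ : NumberField K₀) (_ : Algebra K₀ L), IsGalois K₀ L ∧ IsSolvable (L ≃ₐ[K₀] L) ∧ NumberField.IsTotallyReal K₀ ∧ Module.finrank ℚ K₀ ≤ 5 ∧ ∃ (E : WeierstrassCurve K₀) (_ : E.IsElliptic)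 (χ : Literature.NumberTheory.GaloisRepresentations.FramedGaloisRep L (PadicAlgCl ℓ) 1), ∀ g : Field.absoluteGaloisGroup L, Literature.NumberTheory.GaloisRepresentations.FramedRep.trace (ρ.restrictField L) g = Literature.NumberTheory.GaloisRepresentations.FramedRep.trace χ g * Literature.NumberTheory.GaloisRepresentations.FramedRep.trace ((E.framedTateGaloisRep ℓ).restrictField L) g) ∧ (∃ (L : Type) (_ : Field L) (_ : NumberField L) (_ : Algebra K L), IsGalois K L ∧ IsSolvable (L ≃ₐ[K] L) ∧ ∃ (K₀ : Type) (_ : Field K₀) (_ : NumberField K₀) (_ : Algebra K₀ L), IsGalois K₀ L ∧ IsSolvable (L ≃ₐ[K₀] L) ∧ NumberField.IsTotallyReal K₀ ∧ ∃ (E : WeierstrassCurve K₀) (_ : E.IsElliptic) (χ : Literature.NumberTheory.GaloisRepresentations.FramedGaloisRep L (PadicAlgCl ℓ) 1), ∀ g : Field.absoluteGaloisGroup L, Literature.NumberTheory.GaloisRepresentations.FramedRep.trace (ρ.restrictField L) g = Literature.NumberTheory.GaloisRepresentations.FramedRep.trace χ g * Literature.NumberTheory.GaloisRepresentations.FramedRep.trace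 ((E.framedTateGaloisRep ℓ).restrictField L) g) ∧ ¬ (∃ (L : Type) (_ : Field L) (_ : NumberField L) (_ : Algebra K L), IsGalois K L ∧ IsSolvable (L ≃ₐ[K] L) ∧ ∃ (K₀ : Type) (_ : Field K₀) (_ : NumberField K₀) (_ : Algebra K₀ L), IsGalois K₀ L ∧ IsSolvable (L ≃ₐ[K₀] L) ∧ NumberField.IsTotallyReal K₀ ∧ ((IsGalois ℚ K₀ ∧ (∀ σ τ : K₀ ≃ₐ[ℚ] K₀, σ * τ = τ * σ) ∧ ¬ ((3 : ℤ) ∣ NumberField.discr K₀) ∧ ¬ ((5 : ℤ) ∣ NumberField.discr K₀) ∧ ¬ ((7 : ℤ) ∣ NumberField.discr K₀)) ∨ (∃ p : ℕ, p.Prime ∧ Literature.NumberTheory.Automorphic.Thorne2019.IsInCyclotomicZpExtension p K₀)) ∧ ∃ (E : WeierstrassCurve (NumberField.RingOfIntegers K₀)) (_ : (E.baseChange K₀).IsElliptic) (χ : Literature.NumberTheory.GaloisRepresentations.FramedGaloisRep L (PadicAlgCl ℓ) 1), ∀ g : Field.absoluteGaloisGroup L, Literature.NumberTheory.GaloisRepresentations.FramedRep.trace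 (ρ.restrictField L) g = Literature.NumberTheory.GaloisRepresentations.FramedRep.trace χ g * Literature.NumberTheory.GaloisRepresentations.FramedRep.trace (((E.baseChange K₀).framedTateGaloisRep ℓ).restrictField L) g) ∧ ¬ (∃ (L : Type) (_ : Field L) (_ : NumberField L) (_ : Algebra K L), IsGalois K L ∧ IsSolvable (L ≃ₐ[K] L) ∧ ∃ (K₀ : Type) (_ : Field K₀) (_ : NumberField K₀) (_ : Algebra K₀ L), IsGalois K₀ L ∧ IsSolvable (L ≃ₐ[K₀] L) ∧ NumberField.IsTotallyReal K₀ ∧ (¬ IsSquare (5 : K₀) ∧ ∃ F : IntermediateField ℚ K₀, Module.finrank ℚ F ≤ 5 ∧ IsGalois F K₀ ∧ IsSolvable (K₀ ≃ₐ[F] K₀) ∧ Odd (Module.finrank F K₀) ∧ ∀ x y : K₀, (Literature.NumberTheory.Automorphic.Thorne2019.E₁.baseChange K₀).toAffine.Equation x y → x ∈ Set.range (algebraMap F K₀) ∧ y ∈ Set.range (algebraMap F K₀)) ∧ ∃ (E : WeierstrassCurve (NumberField.RingOfIntegers K₀)) (_ : (E.baseChange K₀).IsElliptic) (χ : Literature.NumberTheory.GaloisRepresentations.FramedGaloisRep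 L (PadicAlgCl ℓ) 1), ∀ g : Field.absoluteGaloisGroup L, Literature.NumberTheory.GaloisRepresentations.FramedRep.trace (ρ.restrictField L) g = Literature.NumberTheory.GaloisRepresentations.FramedRep.trace χ g * Literature.NumberTheory.GaloisRepresentations.FramedRep.trace (((E.baseChange K₀).framedTateGaloisRep ℓ).restrictField L) g) ∧ (∃ (L : Type) (_ : Field L) (_ : NumberField L) (_ : Algebra K L), IsGalois K L ∧ IsSolvable (L ≃ₐ[K] L) ∧ ∃ (K₀ : Type) (_ : Field K₀) (_ : NumberField K₀) (_ : Algebra K₀ L), IsGalois K₀ L ∧ IsSolvable (L ≃ₐ[K₀] L) ∧ NumberField.IsTotallyReal K₀ ∧ (¬ ((7 : ℤ) ∣ NumberField.discr K₀) ∧ ∃ F : IntermediateField ℚ K₀, Module.finrank ℚ F ≤ 5 ∧ IsGalois F K₀ ∧ IsSolvable (K₀ ≃ₐ[F] K₀) ∧ Odd (Module.finrank F K₀) ∧ ∀ x y : K₀, ((⟨1, 0, 0, -4, -1⟩ : WeierstrassCurve ℚ).baseChange K₀).toAffine.Equation x y → x ∈ Set.range (algebraMap F K₀) ∧ y ∈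 Set.range (algebraMap F K₀)) ∧ ∃ (E : WeierstrassCurve (NumberField.RingOfIntegers K₀)) (_ : (E.baseChange K₀).IsElliptic) (χ : Literature.NumberTheory.GaloisRepresentations.FramedGaloisRep L (PadicAlgCl ℓ) 1), ∀ g : Field.absoluteGaloisGroup L, Literature.NumberTheory.GaloisRepresentations.FramedRep.trace (ρ.restrictField L) g = Literature.NumberTheory.GaloisRepresentations.FramedRep.trace χ g * Literature.NumberTheory.GaloisRepresentations.FramedRep.trace (((E.baseChange K₀).framedTateGaloisRep ℓ).restrictField L) g)) → ∃ π : Literature.NumberTheory.Automorphic.CuspidalAutomorphicRepData 2 K hcpt, π.1.IsLAlgebraic ∧ ∀ᶠ v : IsDedekindDomain.HeightOneSpectrum (NumberField.RingOfIntegers K) in Filter.cofinite, SatakeFrobCompatibleAt ι π.1 ρ v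

/-- item stmt-Langlands-26998 · crux · RESIDUAL (gen 0; summit-strength until shown otherwise, D-0170) · leaf IDEA-NEEDED · rank 4 · open · by planner
why it might fail: It contains modularity of EVERY elliptic curve over e.g. every S₆-sextic totally real field: curves with small image at 3, 5 and 7 there have neither a lifting theorem (reducible, non-ordinary-distinguished) nor a descent anchor; only potential/proportion results exist.
sources: corpus:paper:doi-10-4171-8ecm p681 (Thorne, ECM survey: new ideas needed beyond the known TR cases), FreitasLeHungSiksek2015 (Thm 5: all but finitely many j̄ per TR field), Thorne2026FontaineMazurGL2 / arXiv:2608.07186 (proportion results), SkinnerWiles1999 (residually reducible ordinary lifting: the distinguishedness hypothesis that fails in general), tree: EllipticDegreeLadder.EllipticTransportAnyBase (31038), SatakeAvatarExistence (17415), RankOneAutomorphy (24805), HighDegreeEllipticAutomorphy (31034) docstring (towers/doors, INSTRUMENTABLE per field)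
[residual · REST · DECLARED RESIDUAL of this node · IDEA-NEEDED · WEAKER-or-equal than HIGH
(`Cert.rest_of_high`; no `REST → HIGH` / `→ Langlands` / `→ B5`: probes P4/P13, bc7d/h CLEAN) ·
S-implied (`Cert.rest_of_langlands`)] HIGH VERBATIM with ONE conjunct appended: ¬WA ∧ ¬WB5 ∧ ¬WB7 —
ρ has a totally-real elliptic sandwich witness, none of degree ≤ 5, and NO integral TR witness over
an anchored field: not abelian-unramified-at-3·5·7, not a cyclotomic ℤ_p-layer, not an odd solvable
Galois cover of a degree-≤5 field stable for X₀(15) (with √5 ∉ K₀) or for X₀(21) (with 7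
unramified).  On paper: every TR witness field of ρ is an UNANCHORED totally real field of degree ≥
6 (generic example: an S₆-sextic; also even-degree or insoluble covers of small fields, and towers
in which X₀(15) and X₀(21) both grow).  CLOSES (`rest_of_pieces`, 0 sorry) from
`IntegralModelTransferPointwise` (routine: a field-model witness has an integral avatar over the
same K₀ — a Lean lemma on `framedTateGaloisRep` under `VariableChange`), the E-LEVEL RESIDUAL
`UnanchoredHighDegreeModularE` (every integral curve over every unanchored TR field of degree ≥ 6 is
modular — STRICTLY WEAKER than «all curves over all -/
@[route_item "route-Langlands-TowerDoorSplit", crux (bottleneck := idea) (source := "ledger wanted_by.residual on stmt-Langlands-26998, 2026-09-01")]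
def UnanchoredHighDegreeWitnessAutomorphy : Prop :=
  ∀ (K : Type) [Field K] [NumberField K] (hcpt : Literature.NumberTheory.Automorphic.isCompact_glFiniteIntegralLevel 2 K) (ℓ : ℕ) [Fact ℓ.Prime] (ι : PadicAlgCl ℓ ≃+* ℂ) (ρ : Literature.NumberTheory.GaloisRepresentations.FramedGaloisRep K (PadicAlgCl ℓ) 2), ρ.toGaloisRep.IsIrreducible → ((∀ᶠ v : IsDedekindDomain.HeightOneSpectrum (NumberField.RingOfIntegers K) in Filter.cofinite, ρ.IsUnramifiedAt v) ∧ ∀ (v : IsDedekindDomain.HeightOneSpectrum (NumberField.RingOfIntegers K)) (hv : ((ℓ : ℕ) : NumberField.RingOfIntegers K) ∈ v.asIdeal), (Literature.NumberTheory.PAdicHodge.fontainePstAdicCompletion v ℓ hv).IsDeRhamFramed (ρ.toLocal v)) → ¬ (∃ η : Literature.NumberTheory.GaloisRepresentations.FramedGaloisRep K (PadicAlgCl ℓ) 1, (∃ᶠ v : IsDedekindDomain.HeightOneSpectrum (NumberField.RingOfIntegers K) in Filter.cofinite, ∃ a : PadicAlgCl ℓ, a ≠ 1 ∧ η.HasFrobCharpolyAt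 v (Polynomial.X - Polynomial.C a)) ∧ ∀ᶠ v : IsDedekindDomain.HeightOneSpectrum (NumberField.RingOfIntegers K) in Filter.cofinite, ∃ (P : Polynomial (PadicAlgCl ℓ)) (a : PadicAlgCl ℓ), ρ.HasFrobCharpolyAt v P ∧ η.HasFrobCharpolyAt v (Polynomial.X - Polynomial.C a) ∧ P.scaleRoots a = P) → (¬ (∃ (L : Type) (_ : Field L) (_ : NumberField L) (_ : Algebra K L), IsGalois K L ∧ IsSolvable (L ≃ₐ[K] L) ∧ ∃ (K₀ : Type) (_ : Field K₀) (_ : NumberField K₀) (_ : Algebra K₀ L), IsGalois K₀ L ∧ IsSolvable (L ≃ₐ[K₀] L) ∧ NumberField.IsTotallyReal K₀ ∧ Module.finrank ℚ K₀ ≤ 5 ∧ ∃ (E : WeierstrassCurve K₀) (_ : E.IsElliptic) (χ : Literature.NumberTheory.GaloisRepresentations.FramedGaloisRep L (PadicAlgCl ℓ) 1), ∀ g : Field.absoluteGaloisGroup L, Literature.NumberTheory.GaloisRepresentations.FramedRep.trace (ρ.restrictField L) g = Literature.NumberTheory.GaloisRepresentations.FramedRep.trace χ g * Literature.NumberTheory.GaloisRepresentations.FramedRep.trace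 ((E.framedTateGaloisRep ℓ).restrictField L) g) ∧ (∃ (L : Type) (_ : Field L) (_ : NumberField L) (_ : Algebra K L), IsGalois K L ∧ IsSolvable (L ≃ₐ[K] L) ∧ ∃ (K₀ : Type) (_ : Field K₀) (_ : NumberField K₀) (_ : Algebra K₀ L), IsGalois K₀ L ∧ IsSolvable (L ≃ₐ[K₀] L) ∧ NumberField.IsTotallyReal K₀ ∧ ∃ (E : WeierstrassCurve K₀) (_ : E.IsElliptic) (χ : Literature.NumberTheory.GaloisRepresentations.FramedGaloisRep L (PadicAlgCl ℓ) 1), ∀ g : Field.absoluteGaloisGroup L, Literature.NumberTheory.GaloisRepresentations.FramedRep.trace (ρ.restrictField L) g = Literature.NumberTheory.GaloisRepresentations.FramedRep.trace χ g * Literature.NumberTheory.GaloisRepresentations.FramedRep.trace ((E.framedTateGaloisRep ℓ).restrictField L) g) ∧ ¬ (∃ (L : Type) (_ : Field L) (_ : NumberField L) (_ : Algebra K L), IsGalois K L ∧ IsSolvable (L ≃ₐ[K] L) ∧ ∃ (K₀ : Type) (_ : Field K₀) (_ : NumberField K₀) (_ : Algebra K₀ L), IsGalois K₀ L ∧ IsSolvable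 (L ≃ₐ[K₀] L) ∧ NumberField.IsTotallyReal K₀ ∧ ((IsGalois ℚ K₀ ∧ (∀ σ τ : K₀ ≃ₐ[ℚ] K₀, σ * τ = τ * σ) ∧ ¬ ((3 : ℤ) ∣ NumberField.discr K₀) ∧ ¬ ((5 : ℤ) ∣ NumberField.discr K₀) ∧ ¬ ((7 : ℤ) ∣ NumberField.discr K₀)) ∨ (∃ p : ℕ, p.Prime ∧ Literature.NumberTheory.Automorphic.Thorne2019.IsInCyclotomicZpExtension p K₀)) ∧ ∃ (E : WeierstrassCurve (NumberField.RingOfIntegers K₀)) (_ : (E.baseChange K₀).IsElliptic) (χ : Literature.NumberTheory.GaloisRepresentations.FramedGaloisRep L (PadicAlgCl ℓ) 1), ∀ g : Field.absoluteGaloisGroup L, Literature.NumberTheory.GaloisRepresentations.FramedRep.trace (ρ.restrictField L) g = Literature.NumberTheory.GaloisRepresentations.FramedRep.trace χ g * Literature.NumberTheory.GaloisRepresentations.FramedRep.trace (((E.baseChange K₀).framedTateGaloisRep ℓ).restrictField L) g) ∧ ¬ (∃ (L : Type) (_ : Field L) (_ : NumberField L) (_ : Algebra K L), IsGalois K L ∧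 IsSolvable (L ≃ₐ[K] L) ∧ ∃ (K₀ : Type) (_ : Field K₀) (_ : NumberField K₀) (_ : Algebra K₀ L), IsGalois K₀ L ∧ IsSolvable (L ≃ₐ[K₀] L) ∧ NumberField.IsTotallyReal K₀ ∧ (¬ IsSquare (5 : K₀) ∧ ∃ F : IntermediateField ℚ K₀, Module.finrank ℚ F ≤ 5 ∧ IsGalois F K₀ ∧ IsSolvable (K₀ ≃ₐ[F] K₀) ∧ Odd (Module.finrank F K₀) ∧ ∀ x y : K₀, (Literature.NumberTheory.Automorphic.Thorne2019.E₁.baseChange K₀).toAffine.Equation x y → x ∈ Set.range (algebraMap F K₀) ∧ y ∈ Set.range (algebraMap F K₀)) ∧ ∃ (E : WeierstrassCurve (NumberField.RingOfIntegers K₀)) (_ : (E.baseChange K₀).IsElliptic) (χ : Literature.NumberTheory.GaloisRepresentations.FramedGaloisRep L (PadicAlgCl ℓ) 1), ∀ g : Field.absoluteGaloisGroup L, Literature.NumberTheory.GaloisRepresentations.FramedRep.trace (ρ.restrictField L) g = Literature.NumberTheory.GaloisRepresentations.FramedRep.trace χ g * Literature.NumberTheory.GaloisRepresentations.FramedRep.trace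 (((E.baseChange K₀).framedTateGaloisRep ℓ).restrictField L) g) ∧ ¬ (∃ (L : Type) (_ : Field L) (_ : NumberField L) (_ : Algebra K L), IsGalois K L ∧ IsSolvable (L ≃ₐ[K] L) ∧ ∃ (K₀ : Type) (_ : Field K₀) (_ : NumberField K₀) (_ : Algebra K₀ L), IsGalois K₀ L ∧ IsSolvable (L ≃ₐ[K₀] L) ∧ NumberField.IsTotallyReal K₀ ∧ (¬ ((7 : ℤ) ∣ NumberField.discr K₀) ∧ ∃ F : IntermediateField ℚ K₀, Module.finrank ℚ F ≤ 5 ∧ IsGalois F K₀ ∧ IsSolvable (K₀ ≃ₐ[F] K₀) ∧ Odd (Module.finrank F K₀) ∧ ∀ x y : K₀, ((⟨1, 0, 0, -4, -1⟩ : WeierstrassCurve ℚ).baseChange K₀).toAffine.Equation x y → x ∈ Set.range (algebraMap F K₀) ∧ y ∈ Set.range (algebraMap F K₀)) ∧ ∃ (E : WeierstrassCurve (NumberField.RingOfIntegers K₀)) (_ : (E.baseChange K₀).IsElliptic) (χ : Literature.NumberTheory.GaloisRepresentations.FramedGaloisRep L (PadicAlgCl ℓ) 1), ∀ g : Field.absoluteGaloisGroup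 L, Literature.NumberTheory.GaloisRepresentations.FramedRep.trace (ρ.restrictField L) g = Literature.NumberTheory.GaloisRepresentations.FramedRep.trace χ g * Literature.NumberTheory.GaloisRepresentations.FramedRep.trace (((E.baseChange K₀).framedTateGaloisRep ℓ).restrictField L) g)) → ∃ π : Literature.NumberTheory.Automorphic.CuspidalAutomorphicRepData 2 K hcpt, π.1.IsLAlgebraic ∧ ∀ᶠ v : IsDedekindDomain.HeightOneSpectrum (NumberField.RingOfIntegers K) in Filter.cofinite, SatakeFrobCompatibleAt ι π.1 ρ v

/-- item stmt-Langlands-26999 · crux (kind.auto-crux: conjecture-grade) · rank 9 · open · by planner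
why it might fail: Closed at birth modulo ETP/W⁺|₂/R1 and the two facts' statements; fails only if the tree's abelian hypothesis (commuting K₀ ≃ₐ[ℚ] K₀) or `IsInCyclotomicZpExtension` is junk-typed (bc7 CLEAN) or the facts' modules stop building.
sources: Yoshikawa2019 (doi:10.5802/jtnb.1047, Thm 1.2; corpus:paper-arxiv-1606.06597 p3), Thorne2019 (JEMS 21: Thm 1, Lemma 3, Thm 5), tree: Literature/NumberTheory/Automorphic/AbelianTotallyRealModularity.lean (Yoshikawa2019_theorem1_2, .isModularEllipticCurve :66), ThorneQInfinityModular.lean (Thorne2019_thm1 :80–88, IsInCyclotomicZpExtension, E₁, thm5, lemma3), Kato2004 / SkinnerWiles1999 (inside the cited proofs)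
[support · A · PRINT+TREE · CLOSED AT BIRTH modulo ETP + W⁺|₂ + R1
(`Theorems.TowerDoorSplit.a_of_pieces hY hTh hT hW h1`, kernel-checked, 0 sorry, from the NAMED tree
facts `Literature.NumberTheory.Automorphic.Yoshikawa2019_theorem1_2` (via its corollary
`.isModularEllipticCurve`) and `…Thorne2019_thm1`) · WEAKER-or-equal than HIGH (`Cert.a_of_high`; no
`A → HIGH` / `→ Langlands`: probes P1/P10, bc7a/e CLEAN) · binder of `closes`] HIGH VERBATIM with
ONE conjunct appended: WA — SOME totally-real elliptic sandwich witness of ρ is an INTEGRAL model E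
: WeierstrassCurve (𝓞 K₀), (E.baseChange K₀).IsElliptic, over a totally real K₀ that is EITHER
Galois over ℚ with abelian group (∀ σ τ : K₀ ≃ₐ[ℚ] K₀, σ * τ = τ * σ) and 3, 5, 7 unramified (¬ 3 ∣
discr, ¬ 5 ∣ discr, ¬ 7 ∣ discr — the hypotheses of `Yoshikawa2019_theorem1_2` verbatim) OR
satisfies `Thorne2019.IsInCyclotomicZpExtension p K₀` for some prime p (the hypothesis of
`Thorne2019_thm1`).  This is the ASYMPTOTIC REGIME IN PRINT: infinitely many totally real fields of
unbounded degree (ℚ(ζ_N)⁺ for (N, 105) = 1; ℚ_n^{(p)} of degree pⁿ for every p) every curve over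
which is modular today; by `Cert.six_le_finrank_of_witness` only its me -/
@[route_item "route-Langlands-TowerDoorSplit", crux]
def AbelianOrCyclotomicWitnessAutomorphy : Prop :=
  ∀ (K : Type) [Field K] [NumberField K] (hcpt : Literature.NumberTheory.Automorphic.isCompact_glFiniteIntegralLevel 2 K) (ℓ : ℕ) [Fact ℓ.Prime] (ι : PadicAlgCl ℓ ≃+* ℂ) (ρ : Literature.NumberTheory.GaloisRepresentations.FramedGaloisRep K (PadicAlgCl ℓ) 2), ρ.toGaloisRep.IsIrreducible → ((∀ᶠ v : IsDedekindDomain.HeightOneSpectrum (NumberField.RingOfIntegers K) in Filter.cofinite, ρ.IsUnramifiedAt v) ∧ ∀ (v : IsDedekindDomain.HeightOneSpectrum (NumberField.RingOfIntegers K)) (hv : ((ℓ : ℕ) : NumberField.RingOfIntegers K) ∈ v.asIdeal), (Literature.NumberTheory.PAdicHodge.fontainePstAdicCompletion v ℓ hv).IsDeRhamFramed (ρ.toLocal v)) → ¬ (∃ η : Literature.NumberTheory.GaloisRepresentations.FramedGaloisRep K (PadicAlgCl ℓ) 1, (∃ᶠ v : IsDedekindDomain.HeightOneSpectrum (NumberField.RingOfIntegers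 K) in Filter.cofinite, ∃ a : PadicAlgCl ℓ, a ≠ 1 ∧ η.HasFrobCharpolyAt v (Polynomial.X - Polynomial.C a)) ∧ ∀ᶠ v : IsDedekindDomain.HeightOneSpectrum (NumberField.RingOfIntegers K) in Filter.cofinite, ∃ (P : Polynomial (PadicAlgCl ℓ)) (a : PadicAlgCl ℓ), ρ.HasFrobCharpolyAt v P ∧ η.HasFrobCharpolyAt v (Polynomial.X - Polynomial.C a) ∧ P.scaleRoots a = P) → (¬ (∃ (L : Type) (_ : Field L) (_ : NumberField L) (_ : Algebra K L), IsGalois K L ∧ IsSolvable (L ≃ₐ[K] L) ∧ ∃ (K₀ : Type) (_ : Field K₀) (_ : NumberField K₀) (_ : Algebra K₀ L), IsGalois K₀ L ∧ IsSolvable (L ≃ₐ[K₀] L) ∧ NumberField.IsTotallyReal K₀ ∧ Module.finrank ℚ K₀ ≤ 5 ∧ ∃ (E : WeierstrassCurve K₀) (_ : E.IsElliptic) (χ : Literature.NumberTheory.GaloisRepresentations.FramedGaloisRep L (PadicAlgCl ℓ) 1), ∀ g : Field.absoluteGaloisGroup L, Literature.NumberTheory.GaloisRepresentations.FramedRep.trace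 (ρ.restrictField L) g = Literature.NumberTheory.GaloisRepresentations.FramedRep.trace χ g * Literature.NumberTheory.GaloisRepresentations.FramedRep.trace ((E.framedTateGaloisRep ℓ).restrictField L) g) ∧ (∃ (L : Type) (_ : Field L) (_ : NumberField L) (_ : Algebra K L), IsGalois K L ∧ IsSolvable (L ≃ₐ[K] L) ∧ ∃ (K₀ : Type) (_ : Field K₀) (_ : NumberField K₀) (_ : Algebra K₀ L), IsGalois K₀ L ∧ IsSolvable (L ≃ₐ[K₀] L) ∧ NumberField.IsTotallyReal K₀ ∧ ∃ (E : WeierstrassCurve K₀) (_ : E.IsElliptic) (χ : Literature.NumberTheory.GaloisRepresentations.FramedGaloisRep L (PadicAlgCl ℓ) 1), ∀ g : Field.absoluteGaloisGroup L, Literature.NumberTheory.GaloisRepresentations.FramedRep.trace (ρ.restrictField L) g = Literature.NumberTheory.GaloisRepresentations.FramedRep.trace χ g * Literature.NumberTheory.GaloisRepresentations.FramedRep.trace ((E.framedTateGaloisRep ℓ).restrictField L) g) ∧ (∃ (L : Type) (_ : Field L) (_ : NumberField L) (_ : Algebra K L), IsGalois K L ∧ IsSolvable (L ≃ₐ[K]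 L) ∧ ∃ (K₀ : Type) (_ : Field K₀) (_ : NumberField K₀) (_ : Algebra K₀ L), IsGalois K₀ L ∧ IsSolvable (L ≃ₐ[K₀] L) ∧ NumberField.IsTotallyReal K₀ ∧ ((IsGalois ℚ K₀ ∧ (∀ σ τ : K₀ ≃ₐ[ℚ] K₀, σ * τ = τ * σ) ∧ ¬ ((3 : ℤ) ∣ NumberField.discr K₀) ∧ ¬ ((5 : ℤ) ∣ NumberField.discr K₀) ∧ ¬ ((7 : ℤ) ∣ NumberField.discr K₀)) ∨ (∃ p : ℕ, p.Prime ∧ Literature.NumberTheory.Automorphic.Thorne2019.IsInCyclotomicZpExtension p K₀)) ∧ ∃ (E : WeierstrassCurve (NumberField.RingOfIntegers K₀)) (_ : (E.baseChange K₀).IsElliptic) (χ : Literature.NumberTheory.GaloisRepresentations.FramedGaloisRep L (PadicAlgCl ℓ) 1), ∀ g : Field.absoluteGaloisGroup L, Literature.NumberTheory.GaloisRepresentations.FramedRep.trace (ρ.restrictField L) g = Literature.NumberTheory.GaloisRepresentations.FramedRep.trace χ g * Literature.NumberTheory.GaloisRepresentations.FramedRep.trace (((E.baseChange K₀).framedTateGaloisRep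 ℓ).restrictField L) g)) → ∃ π : Literature.NumberTheory.Automorphic.CuspidalAutomorphicRepData 2 K hcpt, π.1.IsLAlgebraic ∧ ∀ᶠ v : IsDedekindDomain.HeightOneSpectrum (NumberField.RingOfIntegers K) in Filter.cofinite, SatakeFrobCompatibleAt ι π.1 ρ v

/-- item stmt-Langlands-28042 · aside · rank 9 · open · by planner
why it might fail: Same single risk as TRANY 31038: solvable DESCENT from L to K for non-cyclic solvable layers needs the twist-primitivity pin at every cyclic step (Lapid–Rogawski); a solvable L/K with a non-descending intermediate twist would break the last arrow.
sources: ArthurClozel1989 (solvable base change for GL(n)), LapidRogawski1998 / Rajan2002 (descent for cyclic layers, multiplicity one up to twist), JacquetShalikaAJM1981 (strong multiplicity one), tree: EllipticDegreeLadder.EllipticTransportAnyBase (31038), EllipticTransport (30189), SatakeAvatarExistence (17415), RankOneAutomorphy (24805); route-Langlands-CMRestImageLocusSplit (same item)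
[support · ETP · PRINT · in-cone as `stub_transport` of the registered skeletons of GEN5/GEN3/LOC15
· S-implied (`Cert.etp_of_langlands`) · no `ETP → CMREST` / `→ Langlands` / `→ any cell` (probes
P14, P20, BC3 rows)] The host transport TRANY = `EllipticDegreeLadder.EllipticTransportAnyBase`
(stmt-Langlands-31038) VERBATIM — same antecedents W⁺|₂ (17415 at n = 2) and R1 (24805,
`Cert.etp_antecedent_R1 : RankOneAutomorphy ↔ … := Iff.rfl`), same (K, ρ, L, K₀) binders of any
signature, same conclusion — EXCEPT the witness block: the witness is an INTEGRAL model `E :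
WeierstrassCurve (𝓞 K₀)` with `(E.baseChange K₀).IsElliptic`, the sandwich runs through
`((E.baseChange K₀).framedTateGaloisRep ℓ).restrictField L`, and only the modularity OF E ITSELF is
assumed (`(E.baseChange K₀).HasCM ∨ ∃ hF π, π.1.HasWeightZero ∧ a.e. Satake = frobTraceAt E`, =
`IsModularEllipticCurve K₀ E` by `Iff.rfl`) instead of TRANY's «∀ E' over 𝓞 K₀ with Δ ≠ 0, E'
modular».  WHY NEEDED: Caraiani–Newton Thm 7.1 is pointwise in E, TRANY is not usable with it.
PRINT CHAIN (identical to TRANY's, which only ever used π_E): E_{K₀} CM ⇒ ρ|Γ_L is an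
induced/character sum, contradicting irreducibility-with-primitivity o -/
@[route_item "route-Langlands-TowerDoorSplit"]
def EllipticTransportPointwise : Prop :=
  (∀ (K : Type) [Field K] [NumberField K] (hcpt : Literature.NumberTheory.Automorphic.isCompact_glFiniteIntegralLevel 2 K) (π : Literature.NumberTheory.Automorphic.CuspidalAutomorphicRepData 2 K hcpt), π.1.IsLAlgebraic → ∀ (ℓ : ℕ) [Fact ℓ.Prime] (ι : PadicAlgCl ℓ ≃+* ℂ), ∃ ρ : Literature.NumberTheory.GaloisRepresentations.FramedGaloisRep K (PadicAlgCl ℓ) 2, ρ.toGaloisRep.IsIrreducible ∧ ∀ᶠ v : IsDedekindDomain.HeightOneSpectrum (NumberField.RingOfIntegers K) in Filter.cofinite, SatakeFrobCompatibleAt ι π.1 ρ v) → (∀ (K : Type) [Field K] [NumberField K] (hcpt : Literature.NumberTheory.Automorphic.isCompact_glFiniteIntegralLevel 1 K) (ℓ : ℕ) [Fact ℓ.Prime] (ι : PadicAlgCl ℓ ≃+* ℂ) (ρ : Literature.NumberTheory.GaloisRepresentations.FramedGaloisRep K (PadicAlgCl ℓ) 1), ρ.toGaloisRep.IsIrreducible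 → ((∀ᶠ v : IsDedekindDomain.HeightOneSpectrum (NumberField.RingOfIntegers K) in cofinite, ρ.IsUnramifiedAt v) ∧ ∀ (v : IsDedekindDomain.HeightOneSpectrum (NumberField.RingOfIntegers K)) (hv : ((ℓ : ℕ) : NumberField.RingOfIntegers K) ∈ v.asIdeal), (Literature.NumberTheory.PAdicHodge.fontainePstAdicCompletion v ℓ hv).IsDeRhamFramed (ρ.toLocal v)) → ∃ π : Literature.NumberTheory.Automorphic.CuspidalAutomorphicRepData 1 K hcpt, π.1.IsLAlgebraic ∧ ∀ᶠ v : IsDedekindDomain.HeightOneSpectrum (NumberField.RingOfIntegers K) in cofinite, SatakeFrobCompatibleAt ι π.1 ρ v) → ∀ (K : Type) [Field K] [NumberField K] (hcpt : Literature.NumberTheory.Automorphic.isCompact_glFiniteIntegralLevel 2 K) (ℓ : ℕ) [Fact ℓ.Prime] (ι : PadicAlgCl ℓ ≃+* ℂ) (ρ : Literature.NumberTheory.GaloisRepresentations.FramedGaloisRep K (PadicAlgCl ℓ) 2), ρ.toGaloisRep.IsIrreducible → ((∀ᶠ v : IsDedekindDomain.HeightOneSpectrum (NumberField.RingOfIntegers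 K) in Filter.cofinite, ρ.IsUnramifiedAt v) ∧ ∀ (v : IsDedekindDomain.HeightOneSpectrum (NumberField.RingOfIntegers K)) (hv : ((ℓ : ℕ) : NumberField.RingOfIntegers K) ∈ v.asIdeal), (Literature.NumberTheory.PAdicHodge.fontainePstAdicCompletion v ℓ hv).IsDeRhamFramed (ρ.toLocal v)) → ¬ (∃ η : Literature.NumberTheory.GaloisRepresentations.FramedGaloisRep K (PadicAlgCl ℓ) 1, (∃ᶠ v : IsDedekindDomain.HeightOneSpectrum (NumberField.RingOfIntegers K) in Filter.cofinite, ∃ a : PadicAlgCl ℓ, a ≠ 1 ∧ η.HasFrobCharpolyAt v (Polynomial.X - Polynomial.C a)) ∧ ∀ᶠ v : IsDedekindDomain.HeightOneSpectrum (NumberField.RingOfIntegers K) in Filter.cofinite, ∃ (P : Polynomial (PadicAlgCl ℓ)) (a : PadicAlgCl ℓ), ρ.HasFrobCharpolyAt v P ∧ η.HasFrobCharpolyAt v (Polynomial.X - Polynomial.C a) ∧ P.scaleRoots a = P) → ∀ (L : Type) [Field L] [NumberField L] [Algebra K L], IsGalois K L → IsSolvable (L ≃ₐ[K] L) → ∀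 (K₀ : Type) [Field K₀] [NumberField K₀] [Algebra K₀ L], IsGalois K₀ L → IsSolvable (L ≃ₐ[K₀] L) → ∀ (E : WeierstrassCurve (NumberField.RingOfIntegers K₀)) [(E.baseChange K₀).IsElliptic] (χ : Literature.NumberTheory.GaloisRepresentations.FramedGaloisRep L (PadicAlgCl ℓ) 1), (∀ g : Field.absoluteGaloisGroup L, Literature.NumberTheory.GaloisRepresentations.FramedRep.trace (ρ.restrictField L) g = Literature.NumberTheory.GaloisRepresentations.FramedRep.trace χ g * Literature.NumberTheory.GaloisRepresentations.FramedRep.trace (((E.baseChange K₀).framedTateGaloisRep ℓ).restrictField L) g) → ((E.baseChange K₀).HasCM ∨ ∃ (hF : Literature.NumberTheory.Automorphic.isCompact_glFiniteIntegralLevel 2 K₀) (π : Literature.NumberTheory.Automorphic.CuspidalAutomorphicRepData 2 K₀ hF), π.1.HasWeightZero ∧ ∀ᶠ w : IsDedekindDomain.HeightOneSpectrum (NumberField.RingOfIntegers K₀) in Filter.cofinite, ∃ α : Multiset ℂ, π.1.HasSatakeParamAt w α ∧ ((Real.sqrt w.residueCard : ℝ) : ℂ) * α.sum = (Literature.NumberTheory.Automorphic.frobTraceAt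 E w : ℂ)) → ∃ π : Literature.NumberTheory.Automorphic.CuspidalAutomorphicRepData 2 K hcpt, π.1.IsLAlgebraic ∧ ∀ᶠ v : IsDedekindDomain.HeightOneSpectrum (NumberField.RingOfIntegers K) in Filter.cofinite, SatakeFrobCompatibleAt ι π.1 ρ v

/-- item stmt-Langlands-27000 · assembly · rank 1 · closed · proved by Summit.Langlands.Langlands.Theorems.towerDoorSplit_assembly_proof (prover) · by planner
[assembly · pure logic · = `Theorems.TowerDoorSplit.closes` / `Cert.high_of_cells` verbatim] A → B5
→ B7 → REST → HIGH (`EllipticDegreeLadder.HighDegreeEllipticAutomorphy`, the refined host crux BY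
NAME): given (K, ρ) in the HIGH box, by_cases on the three inlined dials — WA (⇒ A), else WB5 (⇒
B5), else WB7 (⇒ B7), else REST; no predicate restated.  Through the host:
`Theorems.OffLadderRankTwoAutomorphy_of_split_proof` (HIGH → CMFIN → CMREST → DARK → TRANY → OFF,
landed) and `EllipticDegreeLadder.closes` (12 binders) → `Langlands`
(`Theorems.TowerDoorSplit.closes_root`, axioms propext/Classical.choice/Quot.sound). -/
@[route_item "route-Langlands-TowerDoorSplit"]
def Assembly : Prop :=
  AbelianOrCyclotomicWitnessAutomorphy → FifteenStableCoverWitnessAutomorphy → TwentyOneStableCoverWitnessAutomorphy → UnanchoredHighDegreeWitnessAutomorphy → Summit.Langlands.Langlands.Theses.EllipticDegreeLadder.HighDegreeEllipticAutomorphy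

-- `Assembly` holds: proved by `Summit.Langlands.Langlands.Theorems.towerDoorSplit_assembly_proof` (its module imports this route file, so no `_holds` link can be stated here).

/-! D-0027 §2.1 — DECIDING THEOREM (planner-authored via `route open/edit --closes-file`; by planner-decomp-langlands-writer-1-g8-0 2026-08-31T09:21:53Z):
its hypotheses are this route's items and its conclusion the registered leaf `Summit.Langlands.Langlands.Theses.EllipticDegreeLadder.HighDegreeEllipticAutomorphy` (rung None, D-0061) (glue_lint), and it elaborates with this file. -/

/-- DECIDING THEOREM of the child route `TowerDoorSplit` (cell decomp-langlands, lens 5, gen 19; `refines`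
route-Langlands-EllipticDegreeLadder:HighDegreeEllipticAutomorphy, stmt-Langlands-31034): the four anchoring cells ⟹ the HOST
CRUX HIGH BY NAME (= node kernel `Summit.Langlands.Langlands.Theorems.TowerDoorSplit.Cert.high_of_cells`).  Pure logic; all four binders
are used: three nested excluded middles on the inlined dials WA (integral TR witness over an abelian-unramified-3·5·7 or
cyclotomic-ℤ_p-layer field), WB5 (… over a 15-stable odd solvable cover of a degree-≤5 field, √5 ∉ K₀), WB7 (… 21-stable, 7 unramified). -/
@[closes "route-Langlands-TowerDoorSplit"] theorem closes (hA : AbelianOrCyclotomicWitnessAutomorphy) (hB5 : FifteenStableCoverWitnessAutomorphy)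
    (hB7 : TwentyOneStableCoverWitnessAutomorphy) (hR : UnanchoredHighDegreeWitnessAutomorphy) :
    Summit.Langlands.Langlands.Theses.EllipticDegreeLadder.HighDegreeEllipticAutomorphy := by
  intro K _ _ hcpt ℓ _ ι ρ hirr hgeo htw hbox
  by_cases hWA : (∃ (L : Type) (_ : Field L) (_ : NumberField L) (_ : Algebra K L), IsGalois K L ∧ IsSolvable (L ≃ₐ[K] L) ∧ ∃ (K₀ : Type) (_ : Field K₀) (_ : NumberField K₀) (_ : Algebra K₀ L), IsGalois K₀ L ∧ IsSolvable (L ≃ₐ[K₀] L) ∧ NumberField.IsTotallyReal K₀ ∧ ((IsGalois ℚ K₀ ∧ (∀ σ τ : K₀ ≃ₐ[ℚ] K₀, σ * τ = τ * σ) ∧ ¬ ((3 : ℤ) ∣ NumberField.discr K₀) ∧ ¬ ((5 : ℤ) ∣ NumberField.discr K₀) ∧ ¬ ((7 : ℤ) ∣ NumberField.discr K₀)) ∨ (∃ p : ℕ, p.Prime ∧ Literature.NumberTheory.Automorphic.Thorne2019.IsInCyclotomicZpExtension p K₀)) ∧ ∃ (E : WeierstrassCurve (NumberField.RingOfIntegers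 K₀)) (_ : (E.baseChange K₀).IsElliptic) (χ : Literature.NumberTheory.GaloisRepresentations.FramedGaloisRep L (PadicAlgCl ℓ) 1), ∀ g : Field.absoluteGaloisGroup L, Literature.NumberTheory.GaloisRepresentations.FramedRep.trace (ρ.restrictField L) g = Literature.NumberTheory.GaloisRepresentations.FramedRep.trace χ g * Literature.NumberTheory.GaloisRepresentations.FramedRep.trace (((E.baseChange K₀).framedTateGaloisRep ℓ).restrictField L) g)
  · exact hA K hcpt ℓ ι ρ hirr hgeo htw ⟨hbox.1, hbox.2, hWA⟩
  · by_cases hWB5 : (∃ (L : Type) (_ : Field L) (_ : NumberField L) (_ : Algebra K L), IsGalois K L ∧ IsSolvable (L ≃ₐ[K] L) ∧ ∃ (K₀ : Type) (_ : Field K₀) (_ : NumberField K₀) (_ : Algebra K₀ L), IsGalois K₀ L ∧ IsSolvable (L ≃ₐ[K₀] L) ∧ NumberField.IsTotallyReal K₀ ∧ (¬ IsSquare (5 : K₀) ∧ ∃ F : IntermediateField ℚ K₀, Module.finrank ℚ F ≤ 5 ∧ IsGalois F K₀ ∧ IsSolvable (K₀ ≃ₐ[F] K₀) ∧ Odd (Module.finrank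 F K₀) ∧ ∀ x y : K₀, (Literature.NumberTheory.Automorphic.Thorne2019.E₁.baseChange K₀).toAffine.Equation x y → x ∈ Set.range (algebraMap F K₀) ∧ y ∈ Set.range (algebraMap F K₀)) ∧ ∃ (E : WeierstrassCurve (NumberField.RingOfIntegers K₀)) (_ : (E.baseChange K₀).IsElliptic) (χ : Literature.NumberTheory.GaloisRepresentations.FramedGaloisRep L (PadicAlgCl ℓ) 1), ∀ g : Field.absoluteGaloisGroup L, Literature.NumberTheory.GaloisRepresentations.FramedRep.trace (ρ.restrictField L) g = Literature.NumberTheory.GaloisRepresentations.FramedRep.trace χ g * Literature.NumberTheory.GaloisRepresentations.FramedRep.trace (((E.baseChange K₀).framedTateGaloisRep ℓ).restrictField L) g)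
    · exact hB5 K hcpt ℓ ι ρ hirr hgeo htw ⟨hbox.1, hbox.2, hWA, hWB5⟩
    · by_cases hWB7 : (∃ (L : Type) (_ : Field L) (_ : NumberField L) (_ : Algebra K L), IsGalois K L ∧ IsSolvable (L ≃ₐ[K] L) ∧ ∃ (K₀ : Type) (_ : Field K₀) (_ : NumberField K₀) (_ : Algebra K₀ L), IsGalois K₀ L ∧ IsSolvable (L ≃ₐ[K₀] L) ∧ NumberField.IsTotallyReal K₀ ∧ (¬ ((7 : ℤ) ∣ NumberField.discr K₀) ∧ ∃ F : IntermediateField ℚ K₀, Module.finrank ℚ F ≤ 5 ∧ IsGalois F K₀ ∧ IsSolvable (K₀ ≃ₐ[F] K₀) ∧ Odd (Module.finrank F K₀) ∧ ∀ x y : K₀, ((⟨1, 0, 0, -4, -1⟩ : WeierstrassCurve ℚ).baseChange K₀).toAffine.Equation x y → x ∈ Set.range (algebraMap F K₀) ∧ y ∈ Set.range (algebraMap F K₀)) ∧ ∃ (E : WeierstrassCurve (NumberField.RingOfIntegers K₀)) (_ : (E.baseChange K₀).IsElliptic) (χ : Literature.NumberTheory.GaloisRepresentations.FramedGaloisRep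 L (PadicAlgCl ℓ) 1), ∀ g : Field.absoluteGaloisGroup L, Literature.NumberTheory.GaloisRepresentations.FramedRep.trace (ρ.restrictField L) g = Literature.NumberTheory.GaloisRepresentations.FramedRep.trace χ g * Literature.NumberTheory.GaloisRepresentations.FramedRep.trace (((E.baseChange K₀).framedTateGaloisRep ℓ).restrictField L) g)
      · exact hB7 K hcpt ℓ ι ρ hirr hgeo htw ⟨hbox.1, hbox.2, hWA, hWB5, hWB7⟩
      · exact hR K hcpt ℓ ι ρ hirr hgeo htw ⟨hbox.1, hbox.2, hWA, hWB5, hWB7⟩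

end Summit.Langlands.Langlands.Theses.TowerDoorSplit
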